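import Summits.BirchSwinnertonDyer.BirchSwinnertonDyer.Theorems.KimAtThreeDeepLowerExpStarOmegaBridge
import HarnessLib

/-!
# The registered support item `DefinedKatoUniformThree` (stmt-BirchSwinnertonDyer-20013 = (C1ₑₓ)) BY NAME:
# glue to the five deep decls of W2, and the item from (C1_ω) + `nonempty_neronDeRhamDatum`
# (route `KimAtThreeKolyvagin` rev 14; cell `bsd-addord`, seat w2-c2 gen 8)

HONEST FRAMING: glue with DISPLAYED hypotheses (theorems only; no definition, no named fact, no `sorry`, no
instance); conclusions are route decls BY NAME but CONDITIONAL; nothing is closed or booked; BSD is not proved by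
any of this.

Route rev 14 (planner g20, (γ′) Variant EX) registered the deep leaf's displayed residual as ONE decl,
`Theses.KimAtThreeKolyvagin.DefinedKatoUniformThree` = the (C1ₑₓ) package (`hKU` of w2-c3 g7's p494680) VERBATIM.
This file states, BY NAME of that decl:
* `deepLowerAtThree_of_definedKatoUniformThree` etc. — the five deep decls and `N11.KimAtThreeDeepPUB` from
  `DefinedKatoUniformThree` and the four cite-only leaves (w2-c3 g7's `KimAtThreeDeepLeafOfDefinedKatoUniform`, one
  line each; the item decl unfolds to `hKU` definitionally);
* `definedKatoUniformThree_of_expStarOmega` — **item 20013 BY NAME from (C1_ω) and `nonempty_neronDeRhamDatum`**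
  (this seat's `KimAtThreeDeepLowerExpStarOmegaBridge.definedKatoUniform_of_expStarOmega`: the abstract `φ` of (C1ₑₓ)
  instantiated at the DEFINED `exp*_ω`).
References: [Kato1993LNM1553] Ch. II §1.2.4, Prop. 1.2.3, Ex. 1.3.5; [Kato2004Asterisque] §9.4, Thm. 9.7;
[BlochKato1990] §3; [Kim2025RefinedTNC] Thm 1.1; [Sakamoto2024] Thm. 4.4; [MazurRubin2004] Thm. 5.2.12; [Carayol1986].
-/

set_option autoImplicit false
-- the Theorems namespace of a single-conjunct summit repeats the summit name by design (D-0017)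
set_option linter.dupNamespace false

noncomputable section

open Literature.NumberTheory.PAdicHodge
open Summit.BirchSwinnertonDyer.Rank1Residual.Additive
open Summit.BirchSwinnertonDyer.BirchSwinnertonDyer.Theses.KimAtThreeKolyvagin
open Summit.BirchSwinnertonDyer.BirchSwinnertonDyer.Theorems.KimAtThreeDeepLeafOfDefinedKatoUniform
open Summit.BirchSwinnertonDyer.BirchSwinnertonDyer.Theorems.KimAtThreeDeepLowerExpStarOmegaBridge

namespace Summit.BirchSwinnertonDyer.BirchSwinnertonDyer.Theorems.KimAtThreeDeepLowerExpStarOmegaItem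

/-- **Crux `DeepLowerAtThree` (19075) BY NAME from the registered item `DefinedKatoUniformThree` (20013) and the four
leaves.** Conditional. [cite: Kim2025RefinedTNC, Thm 1.1] [cite: Sakamoto2024, Thm. 4.4 (1)(2) (p. 926)]
[cite: MazurRubin2004, Thm. 5.2.12 and App. A Prop. A.2] -/
theorem deepLowerAtThree_of_definedKatoUniformThree (h : DefinedKatoUniformThree) (hSak : SakamotoKolyvaginThree)
    (hGZK : RankEqAnalyticRankLeOne) (hPT : PoitouTateSelmerDuality) (hlev : CarayolLevelEqConductor) :
    Summit.BirchSwinnertonDyer.BirchSwinnertonDyer.Theses.KimAtThreeKolyvagin.DeepLowerAtThree :=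
  deepLowerAtThree_of_leaves_of_definedKatoUniform h hSak hGZK hPT hlev

/-- **Crux `DeepLowerAtThreeOffKatoStratum` (19679) BY NAME** from item 20013 and three leaves. Conditional.
[cite: Kim2025RefinedTNC, Thm 1.1] [cite: Sakamoto2024, Thm. 4.4 (1)(2) (p. 926)] -/
theorem deepLowerAtThreeOffKatoStratum_of_definedKatoUniformThree (h : DefinedKatoUniformThree)
    (hSak : SakamotoKolyvaginThree) (hGZK : RankEqAnalyticRankLeOne) (hPT : PoitouTateSelmerDuality) :
    Summit.BirchSwinnertonDyer.BirchSwinnertonDyer.Theses.KimAtThreeKolyvagin.DeepLowerAtThreeOffKatoStratum :=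
  deepLowerAtThreeOffKatoStratum_of_leaves_of_definedKatoUniform h hSak hGZK hPT

/-- ★ **`DeepLowerAtThree ∧ DeepUpperAtThree` (19075 ∧ 19076) BY NAME** from item 20013 and the four leaves. Conditional.
[cite: Kim2025RefinedTNC, Thm 1.1] [cite: Sakamoto2024, Thm. 4.4 (1)(2) (p. 926)] [cite: Carayol1986] -/
theorem deepLower_and_deepUpper_of_definedKatoUniformThree (h : DefinedKatoUniformThree)
    (hSak : SakamotoKolyvaginThree) (hGZK : RankEqAnalyticRankLeOne) (hPT : PoitouTateSelmerDuality)
    (hlev : CarayolLevelEqConductor) :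
    Summit.BirchSwinnertonDyer.BirchSwinnertonDyer.Theses.KimAtThreeKolyvagin.DeepLowerAtThree ∧
      Summit.BirchSwinnertonDyer.BirchSwinnertonDyer.Theses.KimAtThreeKolyvagin.DeepUpperAtThree :=
  deepLower_and_deepUpper_of_leaves_of_definedKatoUniform h hSak hGZK hPT hlev

/-- **Crux `DeepUpperAtThreeOffKatoStratum` (19562) BY NAME** from item 20013 and three leaves. Conditional.
[cite: Kim2025RefinedTNC, Thm 1.1] [cite: Sakamoto2024, Thm. 4.4 (1)(2) (p. 926)] -/
theorem deepUpperAtThreeOffKatoStratum_of_definedKatoUniformThree (h : DefinedKatoUniformThree)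
    (hSak : SakamotoKolyvaginThree) (hGZK : RankEqAnalyticRankLeOne) (hPT : PoitouTateSelmerDuality) :
    Summit.BirchSwinnertonDyer.BirchSwinnertonDyer.Theses.KimAtThreeKolyvagin.DeepUpperAtThreeOffKatoStratum :=
  KimAtThreeDeepUpperOfDefinedKatoUniform.deepUpperAtThreeOffKatoStratum_of_leaves_of_definedKatoUniform h hSak hGZK
    hPT

/-- ★★ **`N11.KimAtThreeDeepPUB` BY NAME** from item 20013 and the four leaves (one conjunction). Conditional; nothing booked.
[cite: Kim2025RefinedTNC, Thm 1.1] [cite: Kim2022StructureSelmer, Thm. 1.9 (6), Thm. 3.13] [cite: MazurRubin2004, Thm. 5.2.12]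
[cite: Sakamoto2024, Thm. 4.4 (p. 926)] [cite: Carayol1986] -/
theorem kimAtThreeDeepPUB_of_definedKatoUniformThree (h : DefinedKatoUniformThree) :
    SakamotoKolyvaginThree ∧ RankEqAnalyticRankLeOne ∧ PoitouTateSelmerDuality ∧ CarayolLevelEqConductor →
      N11.KimAtThreeDeepPUB :=
  kimAtThreeDeepPUB_of_leaves_of_definedKatoUniform h

section Omega

open scoped NumberField TensorProduct
open IsDedekindDomain NumberField WeierstrassCurve Literature.NumberTheory.GaloisRepresentations
open Literature.NumberTheory.GaloisCohomology
open Literature.NumberTheory.GaloisRepresentations.PeriodRingData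
open Literature.NumberTheory.EllipticCurves Literature.NumberTheory.EllipticCurves.ModularForms
open Literature.NumberTheory.EllipticCurves.Kato2004 Literature.NumberTheory.EllipticCurves.Kato2004.EulerSystemValues
open Summit.BirchSwinnertonDyer.Rank1Residual.GaloisImage Summit.BirchSwinnertonDyer.Rank1Residual.Additive.LocalLog
open Summit.BirchSwinnertonDyer.BirchSwinnertonDyer.Theorems.KimAtThreeDeepLowerExpStarOmega
open Summit.BirchSwinnertonDyer.BirchSwinnertonDyer.Theorems.KimAtThreeDeepLowerExpStarOmegaPlace

attribute [local instance] valuativeRelPlace topologicalSpacePlace isNonarchimedeanLocalField_place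
  charZero_place padicAlgebraPlace fact_not_isUnit_place isAdicComplete_place

variable
  (hω : ∀ (W : WeierstrassCurve ℚ) [W.IsElliptic] [W.IsGloballyMinimal]
        [ContinuousSMul ℤ_[3] (W.tateModule 3)] [Module.Free ℤ_[3] (W.tateModule 3)]
        [Module.Finite ℤ_[3] (W.tateModule 3)],
        (∀ m : ℕ, W.HasSurjectiveModNGaloisRep (3 ^ m : ℕ)) →
        ∀ (v₃ : HeightOneSpectrum (𝓞 ℚ)) (hv₃ : ((3 : ℕ) : 𝓞 ℚ) ∈ v₃.asIdeal),
        ∀ {N : ℕ} [NeZero N] (P : ModularParametrizationData W N), N = W.conductorNorm ℤ →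
          (∀ z ∈ P.L.lattice, ∃ w ∈ periodLattice P.f, z = P.c * w) →
          (haveI : Fact (((3 : ℕ) : 𝓞 ℚ) ∈ v₃.asIdeal) := ⟨hv₃⟩
          ∀ d : LocalNeronLineAt W 3 v₃,
          ∃ (hinj : (bdRPeriodRingData (valuation_place_lt_one 3 v₃)).CupLogInjective (logCyclotomic 3)
              (localRationalTateRep W 3 (galRestrictPlace v₃)))
            (hex : ∀ z : contOneCocycles (localRationalTateRep W 3 (galRestrictPlace v₃)).toTopRep,
              (bdRPeriodRingData (valuation_place_lt_one 3 v₃)).HasDualExp (logCyclotomic 3)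
                (localRationalTateRep W 3 (galRestrictPlace v₃)) fun σ => z.1 σ)
            (ιp : Place.Completion (Sum.inr v₃ : Place ℚ) →+* ℚ_[3])
            (e : Place.Completion (Sum.inr v₃ : Place ℚ)) (he : e ≠ 0)
            (ι : (n : ℕ) → (CyclotomicField n ℚ →+* ℂ)) (κK : ℝ)
            (Λ : ∀ (k' : ℕ) (r : Finset (HeightOneSpectrum (𝓞 ℚ))),
              H1 (tateRep W 3) (cycSubgroup 3 k' r) →ₗ[ℤ_[3]] ℚ_[3] ⊗[ℚ] CyclotomicField (cycLevel 3 k' r) ℚ),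
            κK ≠ 0 ∧
            -- hker: [BK90] Prop. 3.8 / Ex. 3.11 in lattice form (kernel of `exp*_ω` = `H¹_f = E(ℚ₃) ⊗ ℤ₃`)
            (∀ y, expStarOmegaPadicAt (d.smul e he) hinj hex ιp y = 0 ↔ ∀ j : ℕ, tateLocalMap W 3 j (Sum.inr v₃) y ∈
              W.kummerSelmerStructure (((3 : ℕ) : ℤ) ^ j * ((3 : ℕ) : ℤ)) (Sum.inr v₃)) ∧
            -- hdual: Tate local duality + [BK90] 3.8 in lattice form (`exp*_ω(H¹) = (log_ω E(ℚ₃))^∨`)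
            (∀ a : ℚ_[3], (∃ y, expStarOmegaPadicAt (d.smul e he) hinj hex ιp y = a) ↔
              ∀ Q : (W.baseChange ℚ_[3]).toAffine.Point, ‖a * padicLog (W.baseChange ℚ_[3]) Q‖ ≤ 1) ∧
            -- (X1-int_b): `Λ_{0,r}` agrees with `φ` modulo `3^{j+1-b}·L_int` on restriction-compatible classes
            (∃ b : ℕ, ∀ (j : ℕ) (r : Finset (HeightOneSpectrum (𝓞 ℚ)))
              (Ψ : H1 (tateRep W 3) (cycSubgroup 3 0 r) →+
                continuousCohomology 1 (subgroupRep
                  (W.torsionGaloisModule (((3 : ℕ) : ℤ) ^ j * ((3 : ℕ) : ℤ))).toTopRep (cycSubgroup 3 0 r))),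
              (∀ (φ₁ : contOneCocycles (subgroupRep (tateRep W 3).toTopRep (cycSubgroup 3 0 r)))
                  (ψ : contOneCocycles (subgroupRep
                    (W.torsionGaloisModule (((3 : ℕ) : ℤ) ^ j * ((3 : ℕ) : ℤ))).toTopRep (cycSubgroup 3 0 r))),
                  (∀ g, ((ψ.1 g : geomTorsion W (((3 : ℕ) : ℤ) ^ j * ((3 : ℕ) : ℤ))) : geomPoints W) =
                    TateModule.proj 3 (j + 1) (φ₁.1 g)) →
                  Ψ (oneCocycleClass _ φ₁) = oneCocycleClass _ ψ) →
              ∀ (y : H1 (tateRep W 3) (cycSubgroup 3 0 r))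
                (κ₀ : galoisCohomology (W.torsionGaloisModule (((3 : ℕ) : ℤ) ^ j * ((3 : ℕ) : ℤ))) 1)
                (h : (tateLocalRep W 3 (Sum.inr v₃)).cohomology 1),
                resSubgroup (W.torsionGaloisModule (((3 : ℕ) : ℤ) ^ j * ((3 : ℕ) : ℤ))).toTopRep
                    (cycSubgroup 3 0 r) 1 κ₀ = Ψ y →
                galoisCohomology.localization (W.torsionGaloisModule (((3 : ℕ) : ℤ) ^ j * ((3 : ℕ) : ℤ)))
                    (Sum.inr v₃) 1 κ₀ = tateLocalMap W 3 j (Sum.inr v₃) h →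
                ∃ l ∈ cycIntLattice 3 (cycLevel 3 0 r),
                  (((3 : ℕ) : ℤ_[3]) ^ b) • ((expStarOmegaPadicAt (d.smul e he) hinj hex ιp h ⊗ₜ[ℚ] (1 : CyclotomicField (cycLevel 3 0 r) ℚ)) - Λ 0 r y) =
                    (((3 : ℕ) : ℤ_[3]) ^ (j + 1)) • (l : _)) ∧
            -- Kato's Euler system with its values in the coordinate `Λ`
            ∀ (c d a : ℤ) (A : ℕ), 0 < A → Int.gcd c (6 * 3 * A) = 1 → Int.gcd d (6 * 3 * N) = 1 →
              ∃ (z : ∀ (k' : ℕ) (r : (cyclotomicLevelsRat 3 (badPlaces c d A N)).Ideals),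
                    H1 (tateRep W 3) ((cyclotomicLevelsRat 3 (badPlaces c d A N)).level k' r.1))
                (x : ∀ (k' : ℕ) (r : (cyclotomicLevelsRat 3 (badPlaces c d A N)).Ideals),
                    CyclotomicField (cycLevel 3 k' r.1) ℚ),
                ZetaBody W 3 P.f ι κK Λ c d a A z x))

include hω in
/-- **Item `DefinedKatoUniformThree` (stmt-BirchSwinnertonDyer-20013) BY NAME from (C1_ω) and the construction
statement `PAdicHodge.nonempty_neronDeRhamDatum`**: this seat's `definedKatoUniform_of_expStarOmega` (the abstract
`φ` of (C1ₑₓ) := the DEFINED `expStarOmegaPadicAt (d.smul e he) hinj hex ιp` at the Néron line supplied by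
`nonempty_localNeronLineAt_of_nonempty_neronDeRhamDatum`); the item decl unfolds to the (C1ₑₓ) text definitionally.
Conditional on the displayed (C1_ω). [cite: Kato1993LNM1553, Ch. II §1.2.4 and Ex. 1.3.5] [cite: BlochKato1990, §3 (Prop. 3.8, Ex. 3.11)]
[cite: Kato2004Asterisque, (8.1.3), §9.4, Thm. 9.7 and Ex. 13.3] -/
theorem definedKatoUniformThree_of_expStarOmega (hND : nonempty_neronDeRhamDatum) : DefinedKatoUniformThree :=
  definedKatoUniform_of_expStarOmega hω hND

end Omega

end Summit.BirchSwinnertonDyer.BirchSwinnertonDyer.Theorems.KimAtThreeDeepLowerExpStarOmegaItem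

end
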